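import Mathlib.Computability.Encoding
import Mathlib.Analysis.SpecialFunctions.Log.Base
import Mathlib.Analysis.SpecialFunctions.Pow.Real
import Mathlib.Probability.ProbabilityMassFunction.Constructions
import Literature.Computability.Cryptography.QubitRegister
import Literature.Computability.Cryptography.QuantumCircuit
import HarnessLib

-- provenance: harness21/H21/H21/Prelude/CryptoQuantFine/DihedralCosetProblem.lean @ cda1ccb (interim HEAD d8f2665); M5 mechanical rewrite
/-!
# Regev's dihedral coset problem with failure parameter (trunk CryptoQuantFine, outline Q7)

This prelude file realises the notion `dihedral_coset_problem`. It re-bases, on the qubit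
registers `QReg` (Q1) and quantum circuits `QCircuit`/`QCircuitFamily` over the Clifford+T gate
set (Q2), the provisional section `Literature.PQC.DCP.*` of `H21/Statements/PQC/LatticeComplexity.lean`
with the same names and the same quantifier structure, so that G10's
`usvp_of_dihedralCoset (f) (hf : 0 < f) (h : DCP.HasSolution f)` (pqc.S28) re-points verbatim
(outline R12).

## Informal content

Regev 2004, §1 and Def. 1.2–1.3: the input of `DCP_N` with *failure parameter* `f` consists of
`r = poly(log N)` registers of `1 + ⌈log N⌉` qubits; each register is, with probability at least
`1 - 1/(log N)^f`, in a coset state `(|0, x⟩ + |1, (x + d) mod N⟩)/√2` with `x` arbitrary (worst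
case), and otherwise in a basis state `|b, x⟩` with `b, x` arbitrary; a *solution* is a quantum
algorithm running in time `poly(log N)` that outputs the hidden shift `d` with probability
`≥ 1/poly(log N)`. Regev's Thm. 1.1 reduces `Θ(n^{1/2+2f})`-unique-SVP to `DCP` with failure
parameter `f`; Kuperberg (SIAM J. Comput. 35 (2005), §1) gives a `2^{O(√log N)}` algorithm.

## Layout

With `ℓ = len N = |encodeNat N|` (`= ⌊log₂ N⌋ + 1` for `N ≥ 1`), wires `0 … ℓ-1` hold the
classical input `encodeNat N` (these are the `ℓ` input wires of a circuit family indexed by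
`ℓ`), register `k < r` occupies wires `ℓ + k(ℓ+1) … ℓ + k(ℓ+1) + ℓ` (control bit first, then `x`
in `ℓ` little-endian bits), and all further wires are `0`; registers and workspace live in the
ancillas of the family. The answer `d` is read off the first `ℓ` measured wires.

## Sources

* O. Regev, *Quantum computation and lattice problems*, SIAM J. Comput. 33 (2004), §1,
  Def. 1.2–1.3, Thm. 1.1.
* G. Kuperberg, *A subexponential-time quantum algorithm for the dihedral hidden subgroup
  problem*, SIAM J. Comput. 35 (2005), §1.
* M. A. Nielsen, I. L. Chuang, *Quantum Computation and Quantum Information* (2000), §2.1.7,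
  §2.2.5.

## Mathlib

Used: `Computability.encodeNat`, `Real.logb`, `PMF`, `PMF.pure`, `PMF.toOuterMeasure`,
`Polynomial.eval`, `Nat.testBit`. Mathlib has no dihedral coset / hidden subgroup problem
(searched: `dihedral`, `coset state`, `hidden subgroup`, `HSP`). From H21: `QReg` , `cliffordT`,
`QGateSet.IsUnitary` (Q1); `QCircuit`, `QCircuit.probEvent`, `QCircuitFamily`, `.IsOracleFree`,
`.IsUniform` (Q2).

## Design choices

* Everything lives in `namespace Literature.CryptoQuantFine.DCP`, mirroring `Literature.PQC.DCP`.
* `Register N := Option Bool × Fin N` is the *classical description* of one register's content;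
  the quantum input is the closed-form product state `inputState` (no tensor-product casts).
* Admissible input laws (`IsAdmissible f N μ`) are ARBITRARY joint laws of the `r` register
  contents each of whose marginals is a coset state with probability `≥ 1 - 1/(log₂ N)^f`. This
  class contains Regev's per-register worst-case inputs, and the success requirement `≥ 1/ℓ^c`
  is a `1/poly(log N)`; hence `HasSolution f` IMPLIES solvability in Regev's sense, and pqc.S28
  remains a consequence of Regev's Thm. 1.1.
* There is no `fail : ℕ → ℝ` parameter, no averaging over uniform offsets and no solver
  structure: a solver is a plain `QCircuitFamily cliffordT` (oracle-free, uniform), indexed by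
  the input length `ℓ = len N`, i.e. uniform polynomial time in `log N`.
* The transport instance `cliffordT.instEncodableOp : Encodable cliffordT.Op` (from Q1's
  `Encodable CliffordTOp`, invisible through the projection `cliffordT.Op`) is needed to state
  `QCircuitFamily.IsUniform` for Clifford+T families; it duplicates no Mathlib instance and could
  migrate to Q1.
* Junk values: `qbit s p = false` beyond the width (excluded by the width condition in
  `HasSolution`); `1 / Real.logb 2 N ^ f` uses Mathlib's `rpow` and division conventions, harmless
  for `N ≥ 2`, `0 ≤ f` (the only regime quantified over).
-/

open Computability

namespace Literature.Computability.Cryptography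

/-- The gate alphabet of `cliffordT` is encodable: `cliffordT.Op` is by definition `CliffordTOp`,
whose `Encodable` instance (Q1) is not found through the (non-reducible) projection
`cliffordT.Op`; this instance merely transports it, so that `QCircuitFamily.IsUniform` applies to
Clifford+T families. (Nielsen–Chuang 2000, §4.5.3.) [cite: NielsenChuang2000, §4.5.3] -/
instance cliffordT.instEncodableOp : Encodable cliffordT.Op :=
  inferInstanceAs (Encodable CliffordTOp)

namespace DCP

variable {G : QGateSet} {m : ℕ}

/-- The classical description of the content of one DCP register: `(none, x)` is the coset
state `(|0, x⟩ + |1, (x + d) mod N⟩)/√2` with (arbitrary, worst-case) offset `x`; `(some b, x)`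
is the (failed) basis state `|b, x⟩`. [Regev, SIAM J. Comput. 33 (2004), §1, Def. 1.3] [folklore] -/
abbrev Register (N : ℕ) : Type := Option Bool × Fin N

/-- The input length attached to the modulus `N`: `ℓ = |encodeNat N|` (`= ⌊log₂ N⌋ + 1` for
`N ≥ 1`), so that every `x < N` fits in `ℓ` bits. [Regev 2004, §1 ("`⌈log N⌉` qubits")] [cite: Regev2004, §1 (" ⌈log N⌉  qubits"] -/
def len (N : ℕ) : ℕ := (encodeNat N).length

/-- Bit `p` of a basis label / measurement outcome `s ∈ {0,1}^m`, read as `false` beyond the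
width `m` (junk, excluded by the width condition in `HasSolution`). [Regev 2004, §1] [cite: Regev2004, §1] -/
def qbit (s : QReg m) (p : ℕ) : Bool :=
  if h : p < m then s ⟨p, h⟩ else false

/-- The natural number written little-endian on the `ℓ` wires `p, …, p + ℓ - 1` of the basis
label `s`. [Regev 2004, §1; Arora–Barak 2009, §0.1] [cite: Regev2004, §1] -/
def readNat (s : QReg m) (p ℓ : ℕ) : ℕ :=
  ∑ t ∈ Finset.range ℓ, if qbit s (p + t) then 2 ^ t else 0

/-- The amplitude `⟨c, y | ρ⟩` of the basis state `|c, y⟩` (control bit `c`, data `y`) in the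
register state described by `ρ` with hidden shift `d`: for `ρ = (some b, x)` it is
`[c = b ∧ y = x]`; for `ρ = (none, x)` it is `([c = 0 ∧ y = x] + [c = 1 ∧ y = (x + d) mod N])/√2`.
[Regev 2004, §1, Def. 1.3] [cite: Regev2004, §1  Def. 1.3] -/
noncomputable def registerAmp (N d : ℕ) : Register N → Bool → ℕ → ℂ
  | (some b, x), c, y => if c = b ∧ y = x.val then 1 else 0
  | (none, x), c, y =>
      if (c = false ∧ y = x.val) ∨ (c = true ∧ y = (x.val + d) % N) then
        ((Real.sqrt 2 : ℂ))⁻¹ else 0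

/-- The `m`-qubit pure input state of a DCP instance with modulus `N`, `r` registers with
contents `ρ`, and hidden shift `d`: the product state `|encodeNat N⟩ ⊗ ⨂_k |ρ k⟩ ⊗ |0…0⟩` in
the layout of the module docstring, in closed form: the amplitude of `|s⟩` is
`[prefix of s = encodeNat N] · ∏_k ⟨register k of s | ρ k⟩ · [tail of s = 0]`.
[Regev 2004, §1, Def. 1.3; Nielsen–Chuang 2000, §2.1.7 (product states)] [cite: Regev2004, §1  Def. 1.3] -/
noncomputable def inputState (m N r d : ℕ) (ρ : Fin r → Register N) : QReg m → ℂ := fun s =>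
  (if ∀ t : Fin (len N), qbit s t = (encodeNat N).getD t false then 1 else 0) *
    (∏ k : Fin r, registerAmp N d (ρ k) (qbit s (len N + k * (len N + 1)))
      (readNat s (len N + k * (len N + 1) + 1) (len N))) *
    (if ∀ i : Fin m, len N + r * (len N + 1) ≤ (i : ℕ) → s i = false then 1 else 0)

/-- The success event on `m` measured wires: "the first `ℓ = len N` wires spell `d` in
little-endian binary". [Regev 2004, §1 ("finds `d`")] [cite: Regev2004, §1 ("finds  d "] -/
def successEvent (m N d : ℕ) : Set (QReg m) :=
  {s | ∀ t < len N, qbit s t = d.testBit t}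

/-- The success probability of the (oracle-free semantics of the) circuit `C` on the DCP
instance `(N, d)` whose `r` register contents are drawn from the joint law `μ`:
`∑_ρ μ(ρ) · Pr[measuring U_C |input(ρ)⟩ yields d on the first ℓ wires]` (Born rule,
`QCircuit.probEvent` relative to the empty oracle). [Regev 2004, §1, Def. 1.3;
Nielsen–Chuang 2000, §2.2.5] [cite: Regev2004, §1  Def. 1.3] -/
noncomputable def successProb (C : QCircuit G m) (N d : ℕ) {r : ℕ}
    (μ : PMF (Fin r → Register N)) : ℝ :=
  ∑ ρ : Fin r → Register N,
    (μ ρ).toReal * C.probEvent 0 (inputState m N r d ρ) (successEvent m N d)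

/-- Admissible input laws for failure parameter `f`: a joint law `μ` of the `r` register
contents each of whose marginals is a coset state (`none`) with probability at least
`1 - 1/(log₂ N)^f`. Regev asks this per register with the offsets `x` (and the failed contents
`b, x`) arbitrary; allowing arbitrary joint laws with these marginals only enlarges the input
class, so `HasSolution f` implies solvability in Regev's sense.
[Regev 2004, §1, Def. 1.3 (failure parameter)] [cite: Regev2004, §1  Def. 1.3 (failure parameter] -/
def IsAdmissible (f : ℝ) (N : ℕ) {r : ℕ} (μ : PMF (Fin r → Register N)) : Prop :=
  ∀ k : Fin r,
    1 - 1 / Real.logb 2 N ^ f ≤ (μ.toOuterMeasure {ρ | (ρ k).1 = none}).toReal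

/-- `DCP.HasSolution f`: the dihedral coset problem with failure parameter `f` has a solution —
there are an oracle-free, polynomial-time uniform Clifford+T circuit family `F` (indexed by the
input length `ℓ = len N`, the classical input `encodeNat N` on its `ℓ` input wires), a
polynomially bounded number of registers `r(ℓ)` and an exponent `c` such that for every modulus
`N ≥ 2`, the ancillas of `F` at `ℓ` are wide enough to hold the `r(ℓ)` registers and, for every
shift `d < N` and every admissible input law, `F.circ ℓ` outputs `d` with probability at least
`1/ℓ^c` (`= 1/poly(log N)`; running time `poly(ℓ) = poly(log N)`).
[Regev, SIAM J. Comput. 33 (2004), §1, Def. 1.3 and the paragraph following it; Thm. 1.1] [folklore] -/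
def HasSolution (f : ℝ) : Prop :=
  ∃ F : QCircuitFamily cliffordT, F.IsOracleFree ∧ F.IsUniform ∧
    ∃ r : ℕ → ℕ, (∃ p : Polynomial ℕ, ∀ ℓ, r ℓ ≤ p.eval ℓ) ∧
      ∃ c : ℕ, ∀ N : ℕ, 2 ≤ N →
        r (len N) * (len N + 1) ≤ F.ancillas (len N) ∧
          ∀ d < N, ∀ μ : PMF (Fin (r (len N)) → Register N), IsAdmissible f N μ →
            1 / (len N : ℝ) ^ c ≤ successProb (F.circ (len N)) N d μ

/-! ### API -/

/-- Success probabilities are nonnegative. [folklore] -/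
theorem successProb_nonneg (C : QCircuit G m) (N d : ℕ) {r : ℕ}
    (μ : PMF (Fin r → Register N)) : 0 ≤ successProb C N d μ :=
  Finset.sum_nonneg fun _ _ =>
    mul_nonneg ENNReal.toReal_nonneg (QCircuit.probEvent_nonneg _ _ _ _)

/-- The input state is a unit vector as soon as the register is wide enough to hold the prefix
`encodeNat N` and the `r` registers (each register state, coset or failed, is a unit vector on
its own block of wires, and every `x < N` fits in `len N` bits; no hypothesis on `N`, `d` is
needed). [Regev 2004, §1, Def. 1.3; Nielsen–Chuang 2000, §2.1.7] [cite: Regev2004, §1  Def. 1.3] -/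
def normSq_inputState : Prop :=
  ∀ (m N r d : ℕ) (ρ : Fin r → Register N) (hm : len N + r * (len N + 1) ≤ m),
    ∑ s : QReg m, ‖inputState m N r d ρ s‖ ^ 2 = 1

/-- Over a unitary gate set (e.g. `cliffordT`, `cliffordT_isUnitary`), success probabilities on
a wide enough register are at most `1` (unitarity and `normSq_inputState`).
[Nielsen–Chuang 2000, §2.2.5] [cite: NielsenChuang2000, §2.2.5] -/
def successProb_le_one : Prop :=
  ∀ (hG : G.IsUnitary) (C : QCircuit G m) (N d : ℕ) {r : ℕ} (μ : PMF (Fin r → Register N)) (hm : len N + r * (len N + 1) ≤ m),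
    successProb C N d μ ≤ 1

/-- The all-coset input (every register a coset state, with arbitrary offsets `xs k`) is
admissible for every failure parameter `f` (no sign hypothesis is needed, as `log₂ N > 0`) and
modulus `N ≥ 2`: these are exactly Regev's failure-free inputs. [Regev 2004, §1, Def. 1.2] [cite: Regev2004, §1  Def. 1.2] -/
theorem isAdmissible_pure_none (f : ℝ) {N : ℕ} (hN : 2 ≤ N) {r : ℕ}
    (xs : Fin r → Fin N) :
    IsAdmissible f N (PMF.pure fun k => ((none, xs k) : Register N)) := by
  intro k
  rw [PMF.toOuterMeasure_pure_apply, if_pos (by simp), ENNReal.toReal_one, sub_le_self_iff]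
  have hlog : 0 < Real.logb 2 (N : ℝ) :=
    Real.logb_pos one_lt_two (by exact_mod_cast (Nat.lt_of_lt_of_le one_lt_two hN))
  positivity

/-- Monotonicity in the failure parameter: a larger `f` means fewer failed registers, i.e. a
smaller class of admissible inputs, so a solution for `f` is a solution for every `f' ≥ f`.
[Regev 2004, §1, remark after Def. 1.3] [cite: Regev2004, §1  remark after Def. 1.3] -/
def HasSolution.mono : Prop :=
  ∀ {f f' : ℝ} (hff' : f ≤ f') (h : HasSolution f),
    HasSolution f'

end DCP

end Literature.Computability.Cryptography
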